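import Summits.RiemannHypothesis.RiemannHypothesis.Theorems.SoloInformedTentArch
import Literature.NumberTheory.LFunctions.ZetaScrewThm17Proofs
import Literature.NumberTheory.LFunctions.WeilGroundEnergyProofs
import Literature.NumberTheory.LFunctions.WeilSmallSupportPositivity

/-!
# Weil's criterion on bare interval indicators (solo-informed, T50)

Let `𝟙_a` be the indicator of the open interval `(-a, a)` (`boxTest a`).  Its autocorrelation is
twice the tent of width `2a`,

  `(𝟙_a ⋆ 𝟙̃_a)(x) = (2a - |x|)₊ = 2 Δ_{2a}(x)`     (`weilConv_boxTest_weilReflect`),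

so by the tent evaluation `W(Δ_t) = Ψ(t)` of `SoloInformedTentArch`
(`weilFunctional_tent_eq_zetaScrew`) Weil's quadratic functional AT THE BOX is the screw function:

  `Q(𝟙_a) = W(𝟙_a ⋆ 𝟙̃_a) = 2 Ψ(2a)`     (`weilQuadratic_boxTest`),

and the same for every translate `𝟙_{(c-a, c+a)}` (`weilQuadratic_boxTest_translate`).  With
`‖𝟙_a‖₂² = 2a` the Rayleigh quotient of Weil's form at the box of half-width `a` is `Ψ(2a)/a`
(`re_weilQuadratic_boxTest_div`).  Consequently Suzuki's criterion `RH ↔ Ψ ≥ 0`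
(`Suzuki2023_thm17_holds`, tree) reads: **the Riemann Hypothesis holds iff Weil's quadratic
functional is nonnegative on the indicators of intervals** (`riemannHypothesis_iff_weilQuadratic_boxTest_nonneg`)
— Weil's criterion (`weil_criterion_holds`: `Q ≥ 0` on all smooth compactly supported tests) with
the test class shrunk to the crudest one-parameter family.  No smoothness is involved: `weilQuadratic`
is evaluated literally at the (discontinuous) box, whose autocorrelation is the Lipschitz tent handled
in `SoloInformedTentExplicit` / `SoloInformedTentArch`.

References: M. Suzuki, arXiv:2209.12773 (Kodai Math. J. 47 (2024)), Thm. 1.7; M. Suzuki,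
arXiv:2606.09096 (2026), Thm. 1.1 (`A_a` is the Friedrichs extension of `D* G_a D`, of which the
identity `Q(𝟙_a) = 2Ψ(2a)` is the one-box instance); E. Bombieri, Rend. Mat. Acc. Lincei (9) 11
(2000), Thm. 2.
-/

noncomputable section

open Complex Set MeasureTheory Literature.NumberTheory.LFunctions
open scoped ComplexConjugate

namespace Summit.RiemannHypothesis.RiemannHypothesis.Theorems

/-- The box test: the indicator of the open interval `(-a, a)`, complex-valued. -/
def boxTest (a : ℝ) : ℝ → ℂ := (Ioo (-a) a).indicator fun _ ↦ 1

/-- Unfolding the box test. -/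
theorem boxTest_apply (a x : ℝ) : boxTest a x = if -a < x ∧ x < a then 1 else 0 := by
  simp [boxTest, indicator_apply, mem_Ioo]

/-- The box test is measurable. -/
theorem measurable_boxTest (a : ℝ) : Measurable (boxTest a) :=
  measurable_const.indicator measurableSet_Ioo

/-- `‖𝟙_a(x)‖ ≤ 1`. -/
theorem norm_boxTest_le (a x : ℝ) : ‖boxTest a x‖ ≤ 1 := by
  rw [boxTest_apply]; split_ifs <;> simp

/-- `‖𝟙_a(x)‖² = 𝟙_a(x)` (real indicator). -/
theorem norm_boxTest_sq (a x : ℝ) :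
    ‖boxTest a x‖ ^ 2 = (Ioo (-a) a).indicator (fun _ ↦ (1 : ℝ)) x := by
  simp only [boxTest_apply, indicator_apply, mem_Ioo]; split_ifs <;> simp

/-- `‖𝟙_a‖₂² = 2a` for `a ≥ 0`. -/
theorem integral_norm_sq_boxTest {a : ℝ} (ha : 0 ≤ a) : ∫ x : ℝ, ‖boxTest a x‖ ^ 2 = 2 * a := by
  simp_rw [norm_boxTest_sq]
  rw [integral_indicator_const (1 : ℝ) measurableSet_Ioo, smul_eq_mul, mul_one, Real.volume_real_Ioo,
    max_eq_left (by linarith)]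
  ring

/-- The integrand of the autocorrelation of the box is the indicator of
`(max(-a, x-a), min(a, x+a))`. -/
theorem boxTest_mul_weilReflect (a x u : ℝ) :
    boxTest a u * weilReflect (boxTest a) (x - u) =
      (Ioo (max (-a) (x - a)) (min a (x + a))).indicator (fun _ ↦ (1 : ℂ)) u := by
  simp only [weilReflect, boxTest_apply, neg_sub, indicator_apply, mem_Ioo, max_lt_iff, lt_min_iff]
  by_cases h1 : -a < u ∧ u < a
  · by_cases h2 : -a < u - x ∧ u - x < a
    · have h3 : (-a < u ∧ x - a < u) ∧ (u < a ∧ u < x + a) :=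
        ⟨⟨h1.1, by linarith [h2.1]⟩, h1.2, by linarith [h2.2]⟩
      rw [if_pos h1, if_pos h2, if_pos h3]
      simp
    · have h3 : ¬((-a < u ∧ x - a < u) ∧ (u < a ∧ u < x + a)) :=
        fun h ↦ h2 ⟨by linarith [h.1.2], by linarith [h.2.2]⟩
      rw [if_pos h1, if_neg h2, if_neg h3]
      simp
  · have h3 : ¬((-a < u ∧ x - a < u) ∧ (u < a ∧ u < x + a)) := fun h ↦ h1 ⟨h.1.1, h.2.1⟩
    rw [if_neg h1, if_neg h3]
    simp

/-- **The autocorrelation of the box is twice the tent**: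
`(𝟙_a ⋆ 𝟙̃_a)(x) = (2a - |x|)₊ = 2 Δ_{2a}(x)` (for every real `a`; both sides vanish for `a ≤ 0`). -/
theorem weilConv_boxTest_weilReflect (a x : ℝ) :
    weilConv (boxTest a) (weilReflect (boxTest a)) x = 2 * tent (2 * a) x := by
  rw [weilConv_apply]
  simp_rw [boxTest_mul_weilReflect]
  rw [integral_indicator_const (1 : ℂ) measurableSet_Ioo, Real.volume_real_Ioo, tent_apply]
  have h : min a (x + a) - max (-a) (x - a) = 2 * a - |x| := by
    rcases le_or_gt 0 x with hx | hx
    · rw [min_eq_left (by linarith), max_eq_right (by linarith), abs_of_nonneg hx]; ring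
    · rw [min_eq_right (by linarith), max_eq_left (by linarith), abs_of_neg hx]; ring
  rw [h, Complex.real_smul, mul_one]
  push_cast
  ring

/-- The same as an identity of functions. -/
theorem weilConv_boxTest_weilReflect_eq (a : ℝ) :
    weilConv (boxTest a) (weilReflect (boxTest a)) = fun x ↦ 2 * tent (2 * a) x :=
  funext (weilConv_boxTest_weilReflect a)

/-- **Weil's quadratic functional at the box is the screw function**: `Q(𝟙_a) = 2 Ψ(2a)` (`a ≥ 0`). -/
theorem weilQuadratic_boxTest {a : ℝ} (ha : 0 ≤ a) :
    weilQuadratic (boxTest a) = 2 * (zetaScrew (2 * a) : ℂ) := by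
  rw [weilQuadratic, weilConv_boxTest_weilReflect_eq, weilFunctional_const_mul,
    weilFunctional_tent_eq_zetaScrew (by positivity)]

/-- Real part: `Re Q(𝟙_a) = 2 Ψ(2a)`. -/
theorem re_weilQuadratic_boxTest {a : ℝ} (ha : 0 ≤ a) :
    (weilQuadratic (boxTest a)).re = 2 * zetaScrew (2 * a) := by
  rw [weilQuadratic_boxTest ha]
  simp

/-- Translates: `Q(𝟙_{(c-a, c+a)}) = 2 Ψ(2a)` — the autocorrelation is translation invariant
(`weilConv_weilReflect_translate`). Here the translate is written `x ↦ 𝟙_a(x + m)`, the indicator of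
`(-m-a, -m+a)`. -/
theorem weilQuadratic_boxTest_translate {a : ℝ} (ha : 0 ≤ a) (m : ℝ) :
    weilQuadratic (fun x ↦ boxTest a (x + m)) = 2 * (zetaScrew (2 * a) : ℂ) := by
  rw [weilQuadratic, weilConv_weilReflect_translate, ← weilQuadratic, weilQuadratic_boxTest ha]

/-- **The Rayleigh quotient of Weil's form at the box of half-width `a` is `Ψ(2a)/a`** (`a > 0`). -/
theorem re_weilQuadratic_boxTest_div {a : ℝ} (ha : 0 < a) :
    (weilQuadratic (boxTest a)).re / ∫ x : ℝ, ‖boxTest a x‖ ^ 2 = zetaScrew (2 * a) / a := by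
  rw [re_weilQuadratic_boxTest ha.le, integral_norm_sq_boxTest ha.le]
  field_simp

/-- **Weil's criterion on bare interval indicators.** The Riemann Hypothesis holds iff Weil's
quadratic functional `Q(g) = W(g ⋆ g̃)` is nonnegative at the indicator of every interval `(-a, a)`,
`a > 0` (equivalently, by `weilQuadratic_boxTest_translate`, of every bounded open interval).
(`⇒`: `Q(𝟙_a) = 2Ψ(2a) ≥ 0` under RH, `ZetaScrewThm17.zetaScrew_nonneg_of_RH`; `⇐`: `Ψ(t) = Q(𝟙_{|t|/2})/2 ≥ 0`
for all `t`, then Suzuki's Theorem 1.7, `riemannHypothesis_of_zetaScrew_nonneg`.) -/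
theorem riemannHypothesis_iff_weilQuadratic_boxTest_nonneg :
    RiemannHypothesis ↔ ∀ a : ℝ, 0 < a → 0 ≤ (weilQuadratic (boxTest a)).re := by
  constructor
  · intro hRH a ha
    rw [re_weilQuadratic_boxTest ha.le]
    exact mul_nonneg zero_le_two (ZetaScrewThm17.zetaScrew_nonneg_of_RH hRH _)
  · intro h
    refine riemannHypothesis_of_zetaScrew_nonneg fun t ↦ ?_
    rcases eq_or_ne t 0 with rfl | ht
    · rw [zetaScrew_zero]
    · have hpos : 0 < |t| / 2 := by positivity
      have := h _ hpos
      rw [re_weilQuadratic_boxTest hpos.le, mul_div_cancel₀ _ (two_ne_zero), zetaScrew_abs] at this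
      linarith

/-- One-sided form: a negative value of the screw function exhibits an explicit test of negative
Weil energy — the box of half-width `t/2` — so Weil positivity fails already on bounded-support
(non-smooth) tests at that scale. -/
theorem re_weilQuadratic_boxTest_neg_of_zetaScrew_neg {t : ℝ} (ht : 0 < t) (hΨ : zetaScrew t < 0) :
    (weilQuadratic (boxTest (t / 2))).re < 0 := by
  rw [re_weilQuadratic_boxTest (by positivity), mul_div_cancel₀ _ (two_ne_zero)]
  linarith

end Summit.RiemannHypothesis.RiemannHypothesis.Theorems
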